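import Mathlib
import HarnessLib
import Summits.Langlands.Langlands.Theorems.EisensteinGelfandKirillovProModularOfGKBoundTwoLeafFernDefs
import Literature.NumberTheory.Automorphic.ReciprocityGLnQlModelProofs
import Literature.NumberTheory.GaloisRepresentations.PadicIntermediateFieldIntegers
import Literature.NumberTheory.GaloisRepresentations.PseudocharacterTaylorProofs
import Literature.NumberTheory.GaloisRepresentations.AbsolutelyIrreducibleReduction

/-!
# Route `EisensteinGelfandKirillov`, crux `ProModularOfGKBound` (stmt-Langlands-18273), line `two-leaf-fern`:
# the TRACE ALGEBRA of the lifts of `ρ` (construction behind `stub_host`), part 1 — the ring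

For `ρ : Γ_F → GL₂(ℚ̄_p)` with an `O`-integral model `ρ₀` (`O = 𝒪_{ℚ̄_p}`), let `S` be the set (type
`LiftDatum`) of all LIFTS as in clause (U2) of the line's interface `Host`: pairs `(ρ', ρ'₀)` with `ρ'₀ ↦ ρ'`
entrywise, `tr ρ'₀ ≡ tr ρ₀ (mod 𝔪_O)`, `det ρ'₀ = det ρ₀`, `ρ'` unramified outside `badSet p ρ`.  Each
`ρ'` has a model over a finite `E_{ρ'}/ℚ_p` (`exists_hasQlModel_holds`, Baire), so its traces lie in the
COMPACT ring `E_{ρ'} ∩ O`.  The **trace algebra** is the closed subring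
`R_tr = closure ℤ[(tr ρ'(g))_{ρ'} : g ∈ Γ_F] ⊆ ∏_{ρ' ∈ S} ℚ̄_p`; it lies in the compact `∏ (E_{ρ'} ∩ O)`,
hence is a compact Hausdorff topological ring (`TraceHost.ring`, `compactSpace_ring`), it carries the
continuous `2`-dimensional pseudocharacter `T = (tr ρ')_{ρ'}` (`TraceHost.pseudochar`) whose values generate
it topologically (`traces_dense`), and it is LOCAL with `p` in the maximal ideal (`isLocalRing_ring`,
`natCast_mem_maximalIdeal`): the reduction `r ↦ (r_{ρ'} mod 𝔪_O)` does not depend on `ρ'` (it is locally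
constant in `r` and constant on the generators by the trace congruence), and an element all of whose
coordinates are units of `O` is a unit of `R_tr` (the closure of its positive powers is a compact semigroup,
hence contains an idempotent — necessarily `1` — so the coordinatewise inverse lies in `R_tr`).
Part 2 (`…StubHost.lean`) adds the points, the Galois-equivariant determinant clause and `stub_host`.
References: [cite: Chenevier2014, §3 (universal deformation ring of a determinant), Ex. 3.7]
[cite: BellaicheChenevier2009, §1.4]; Ellis–Numakura lemma (Mathlib `exists_idempotent_in_compact_subsemigroup`).
-/

set_option linter.dupNamespace false
set_option autoImplicit false

noncomputable section

open scoped NumberField Matrix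
open Filter Field IsDedekindDomain Topology
open Literature.NumberTheory.GaloisRepresentations Literature.NumberTheory.Automorphic
open Literature.NumberTheory.Automorphic.BigHeckeGLn

namespace Summit.Langlands.Langlands.Cruxes.ProModularOfGKBound.TwoLeafFern

namespace TraceHost

variable {F : Type} [Field F] [NumberField F] {p : ℕ} [Fact p.Prime]

/-- `O = 𝒪_{ℚ̄_p}`, the valuation ring (closed unit ball) of `ℚ̄_p = PadicAlgCl p`. [folklore] -/
abbrev Oint (p : ℕ) [Fact p.Prime] : ValuationSubring (PadicAlgCl p) :=
  (Valued.v : Valuation (PadicAlgCl p) NNReal).valuationSubring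

/-- Membership in `O`: norm at most one. [folklore] -/
theorem mem_Oint_iff (x : PadicAlgCl p) : x ∈ Oint p ↔ ‖x‖ ≤ 1 :=
  padicAlgCl_mem_valuationSubring_iff p x

/-- **A lift datum** (an index of the trace algebra): a continuous `ρ' : Γ_F → GL₂(ℚ̄_p)` with an
`O`-model `ρ'₀` in the same frame, traces congruent to those of `ρ₀` modulo `𝔪_O`, determinant equal to
`det ρ₀`, unramified outside `badSet p ρ` — verbatim the hypotheses of clause (U2) of `Host`. [folklore] -/
structure LiftDatum (p : ℕ) [Fact p.Prime] (ρ : FramedGaloisRep F (PadicAlgCl p) 2)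
    (ρ₀ : absoluteGaloisGroup F →* GL (Fin 2) (Oint p)) : Type where
  /-- The lift `ρ'`. -/
  rep : FramedGaloisRep F (PadicAlgCl p) 2
  /-- Its `O`-model `ρ'₀`. -/
  model : absoluteGaloisGroup F →* GL (Fin 2) (Oint p)
  map_model : ∀ g, Matrix.GeneralLinearGroup.map (Oint p).subtype (model g) = rep g
  trace_congr : ∀ g, (model g).val.trace - (ρ₀ g).val.trace ∈ IsLocalRing.maximalIdeal (Oint p)
  det_eq : ∀ g, (model g).val.det = (ρ₀ g).val.det
  unram : ∀ v, v ∉ badSet p ρ → rep.IsUnramifiedAt v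

variable {ρ : FramedGaloisRep F (PadicAlgCl p) 2} {ρ₀ : absoluteGaloisGroup F →* GL (Fin 2) (Oint p)}

namespace LiftDatum

/-- The trace of `ρ'(g)` is the image of the trace of the model. [folklore] -/
theorem trace_rep (s : LiftDatum p ρ ρ₀) (g : absoluteGaloisGroup F) :
    FramedRep.trace s.rep g = ((s.model g).val.trace : PadicAlgCl p) := by
  rw [FramedRep.trace, ← s.map_model g]
  exact (AddMonoidHom.map_trace (Oint p).subtype.toAddMonoidHom (s.model g).val).symm

/-- The determinant of `ρ'(g)` is the image of `det ρ₀(g)`. [folklore] -/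
theorem det_rep (s : LiftDatum p ρ ρ₀) (g : absoluteGaloisGroup F) :
    ((s.rep g : GL (Fin 2) (PadicAlgCl p)) : Matrix (Fin 2) (Fin 2) (PadicAlgCl p)).det =
      ((ρ₀ g).val.det : PadicAlgCl p) := by
  rw [← s.map_model g, ← s.det_eq g]
  exact (RingHom.map_det (Oint p).subtype (s.model g).val).symm

/-- Traces of a lift have norm at most one. [folklore] -/
theorem norm_trace_le_one (s : LiftDatum p ρ ρ₀) (g : absoluteGaloisGroup F) :
    ‖FramedRep.trace s.rep g‖ ≤ 1 := by
  rw [trace_rep]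
  exact (mem_Oint_iff _).1 (s.model g).val.trace.2

/-- A finite extension `E_{ρ'} ⊆ ℚ̄_p` of `ℚ_p` over which `ρ'` has a model (`exists_hasQlModel_holds`).
[cite: BuzzardGeeLMS2014, footnote to Conj. 3.2.1] -/
def fld (s : LiftDatum p ρ ρ₀) : IntermediateField ℚ_[p] (PadicAlgCl p) :=
  (exists_hasQlModel_holds s.rep).choose

/-- `E_{ρ'}` is finite over `ℚ_p`. [folklore] -/
instance finiteDimensional_fld (s : LiftDatum p ρ ρ₀) : FiniteDimensional ℚ_[p] s.fld :=
  (exists_hasQlModel_holds s.rep).choose_spec.choose_spec.1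

omit [NumberField F] in
/-- Traces of a representation with a model over `E` lie in `E` (trace is a conjugation invariant and
commutes with base change). [folklore] -/
theorem trace_mem_of_hasQlModel {r : FramedGaloisRep F (PadicAlgCl p) 2}
    {E : IntermediateField ℚ_[p] (PadicAlgCl p)} {rE : FramedGaloisRep F E 2} (h : HasQlModel r E rE)
    (g : absoluteGaloisGroup F) : FramedRep.trace r g ∈ E := by
  obtain ⟨P, hP⟩ := h
  rw [FramedRep.trace, ← hP, FramedRep.conj_apply, Units.val_mul, Units.val_mul, Matrix.trace_units_conj,
    FramedRep.baseChange_apply]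
  have e : (((rE g).val.map (algebraMap E (PadicAlgCl p))).trace) = algebraMap E (PadicAlgCl p) (rE g).val.trace :=
    (AddMonoidHom.map_trace (algebraMap E (PadicAlgCl p)).toAddMonoidHom (rE g).val).symm
  exact e ▸ SetLike.coe_mem _

omit [NumberField F] in
/-- Determinants of a representation with a model over `E` lie in `E`. [folklore] -/
theorem det_mem_of_hasQlModel {r : FramedGaloisRep F (PadicAlgCl p) 2}
    {E : IntermediateField ℚ_[p] (PadicAlgCl p)} {rE : FramedGaloisRep F E 2} (h : HasQlModel r E rE)
    (g : absoluteGaloisGroup F) :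
    ((r g : GL (Fin 2) (PadicAlgCl p)) : Matrix (Fin 2) (Fin 2) (PadicAlgCl p)).det ∈ E := by
  obtain ⟨P, hP⟩ := h
  rw [← hP, FramedRep.conj_apply, Units.val_mul, Units.val_mul, Matrix.det_units_conj,
    FramedRep.baseChange_apply]
  have e : (((rE g).val.map (algebraMap E (PadicAlgCl p))).det) = algebraMap E (PadicAlgCl p) (rE g).val.det :=
    (RingHom.map_det (algebraMap E (PadicAlgCl p)) (rE g).val).symm
  exact e ▸ SetLike.coe_mem _

/-- Traces of `ρ'` lie in `E_{ρ'}`. [folklore] -/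
theorem trace_mem_fld (s : LiftDatum p ρ ρ₀) (g : absoluteGaloisGroup F) : FramedRep.trace s.rep g ∈ s.fld :=
  trace_mem_of_hasQlModel (exists_hasQlModel_holds s.rep).choose_spec.choose_spec.2 g

/-- Determinants of `ρ'` lie in `E_{ρ'}`. [folklore] -/
theorem det_mem_fld (s : LiftDatum p ρ ρ₀) (g : absoluteGaloisGroup F) :
    ((s.rep g : GL (Fin 2) (PadicAlgCl p)) : Matrix (Fin 2) (Fin 2) (PadicAlgCl p)).det ∈ s.fld :=
  det_mem_of_hasQlModel (exists_hasQlModel_holds s.rep).choose_spec.choose_spec.2 g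

/-- The compact coordinate ring `E_{ρ'} ∩ O` of the factor indexed by `ρ'`. [folklore] -/
def ball (s : LiftDatum p ρ ρ₀) : Subring (PadicAlgCl p) := s.fld.toSubring ⊓ (Oint p).toSubring

/-- Membership in `E_{ρ'} ∩ O`. [folklore] -/
theorem mem_ball_iff (s : LiftDatum p ρ ρ₀) (x : PadicAlgCl p) : x ∈ s.ball ↔ x ∈ s.fld ∧ ‖x‖ ≤ 1 := by
  rw [ball, Subring.mem_inf]
  exact and_congr Iff.rfl (mem_Oint_iff x)

/-- `E_{ρ'} ∩ O` is compact (the closed unit ball of the finite-dimensional `ℚ_p`-space `E_{ρ'}`). [folklore] -/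
theorem isCompact_ball (s : LiftDatum p ρ ρ₀) : IsCompact (s.ball : Set (PadicAlgCl p)) := by
  have h := (intermediateFieldIntegers.isCompact_setOf_norm_le_one s.fld).image continuous_subtype_val
  convert h using 1
  ext x
  simp only [SetLike.mem_coe, mem_ball_iff, Set.mem_image, Set.mem_setOf_eq]
  constructor
  · rintro ⟨hx, hn⟩
    exact ⟨⟨x, hx⟩, hn, rfl⟩
  · rintro ⟨y, hy, rfl⟩
    exact ⟨y.2, hy⟩

/-- Traces of `ρ'` lie in `E_{ρ'} ∩ O`. [folklore] -/
theorem trace_mem_ball (s : LiftDatum p ρ ρ₀) (g : absoluteGaloisGroup F) : FramedRep.trace s.rep g ∈ s.ball :=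
  (mem_ball_iff s _).2 ⟨s.trace_mem_fld g, s.norm_trace_le_one g⟩

end LiftDatum

variable (ρ ρ₀)

/-- The ambient product ring `∏_{ρ' ∈ S} ℚ̄_p`. [folklore] -/
abbrev Amb : Type := LiftDatum p ρ ρ₀ → PadicAlgCl p

/-- The family of traces `g ↦ (tr ρ'(g))_{ρ'}`. [folklore] -/
def tracePi (g : absoluteGaloisGroup F) : Amb ρ ρ₀ := fun s => FramedRep.trace s.rep g

/-- The box `∏ (E_{ρ'} ∩ O)`, a closed compact subring of the ambient product. [folklore] -/
def box : Subring (Amb ρ ρ₀) := ⨅ s, (LiftDatum.ball s).comap (Pi.evalRingHom (fun _ => PadicAlgCl p) s)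

/-- **The trace algebra `R_tr`**: the closure of the subring generated by the families of traces. [folklore] -/
def ring : Subring (Amb ρ ρ₀) := (Subring.closure (Set.range (tracePi ρ ρ₀))).topologicalClosure

variable {ρ ρ₀}

/-- Membership in the box is coordinatewise. [folklore] -/
theorem mem_box_iff (f : Amb ρ ρ₀) : f ∈ box ρ ρ₀ ↔ ∀ s, f s ∈ LiftDatum.ball s := by
  simp [box, Subring.mem_iInf]

/-- The box is the product set `∏ (E_{ρ'} ∩ O)`. [folklore] -/
theorem coe_box : (box ρ ρ₀ : Set (Amb ρ ρ₀)) = Set.univ.pi fun s => (LiftDatum.ball s : Set (PadicAlgCl p)) := by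
  ext f
  simp [mem_box_iff]

/-- The box is compact (Tychonoff). [folklore] -/
theorem isCompact_box : IsCompact (box ρ ρ₀ : Set (Amb ρ ρ₀)) := by
  rw [coe_box]
  exact isCompact_univ_pi fun s => LiftDatum.isCompact_ball s

/-- `R_tr` lies in the box. [folklore] -/
theorem ring_le_box : ring ρ ρ₀ ≤ box ρ ρ₀ := by
  refine Subring.topologicalClosure_minimal _ ?_ isCompact_box.isClosed
  refine Subring.closure_le.2 ?_
  rintro _ ⟨g, rfl⟩
  exact (mem_box_iff _).2 fun s => LiftDatum.trace_mem_ball s g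

/-- Coordinates of elements of `R_tr` lie in `E_{ρ'} ∩ O`. [folklore] -/
theorem apply_mem_ball (r : ring ρ ρ₀) (s : LiftDatum p ρ ρ₀) : (r : Amb ρ ρ₀) s ∈ LiftDatum.ball s :=
  (mem_box_iff _).1 (ring_le_box r.2) s

/-- Coordinates of elements of `R_tr` have norm at most one. [folklore] -/
theorem norm_apply_le_one (r : ring ρ ρ₀) (s : LiftDatum p ρ ρ₀) : ‖(r : Amb ρ ρ₀) s‖ ≤ 1 :=
  ((LiftDatum.mem_ball_iff s _).1 (apply_mem_ball r s)).2

/-- `R_tr` is compact (closed in the compact box). [folklore] -/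
instance compactSpace_ring : CompactSpace (ring ρ ρ₀) :=
  isCompact_iff_compactSpace.1
    (isCompact_box.of_isClosed_subset (Subring.isClosed_topologicalClosure _) ring_le_box)

/-- The families of traces lie in `R_tr`. [folklore] -/
theorem tracePi_mem (g : absoluteGaloisGroup F) : tracePi ρ ρ₀ g ∈ ring ρ ρ₀ :=
  (Subring.closure _).le_topologicalClosure (Subring.subset_closure ⟨g, rfl⟩)

/-- The trace family as an `R_tr`-valued function. [folklore] -/
def traceR (g : absoluteGaloisGroup F) : ring ρ ρ₀ := ⟨tracePi ρ ρ₀ g, tracePi_mem g⟩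

/-- Unfolding lemma for `traceR`. [folklore] -/
@[simp] theorem coe_traceR (g : absoluteGaloisGroup F) :
    ((traceR (ρ := ρ) (ρ₀ := ρ₀) g : ring ρ ρ₀) : Amb ρ ρ₀) = tracePi ρ ρ₀ g := rfl

/-- The trace family is a pseudocharacter of dimension `2` (coordinatewise: traces of representations are
pseudocharacters, `Rouquier1996_prop_3_1_trace_holds`). [cite: Rouquier1996, Prop. 3.1] -/
theorem isPseudocharacter_traceR : IsPseudocharacter (traceR (ρ := ρ) (ρ₀ := ρ₀)) 2 := by
  have hcoord : ∀ s : LiftDatum p ρ ρ₀,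
      IsPseudocharacter (fun g => FramedRep.trace s.rep g) 2 := fun s =>
    Rouquier1996_prop_3_1_trace_holds _ _ 2 s.rep.toMonoidHom
  have hpi : IsPseudocharacter (tracePi ρ ρ₀) 2 := by
    refine ⟨?_, ?_, ?_⟩
    · funext s
      exact (hcoord s).map_one
    · intro g h
      funext s
      exact (hcoord s).map_mul_comm g h
    · intro x
      funext s
      have h := frobeniusS_map (tracePi ρ ρ₀) (Pi.evalRingHom (fun _ => PadicAlgCl p) s) 3 x
      rw [Pi.evalRingHom_apply] at h
      rw [← h]
      exact (hcoord s).frobenius x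
  refine ⟨?_, ?_, ?_⟩
  · exact Subtype.ext hpi.map_one
  · intro g h
    exact Subtype.ext (hpi.map_mul_comm g h)
  · intro x
    apply Subtype.ext
    have h := frobeniusS_map (traceR (ρ := ρ) (ρ₀ := ρ₀)) (ring ρ ρ₀).subtype 3 x
    rw [Subring.coe_subtype] at h
    change ((frobeniusS traceR 3 x : ring ρ ρ₀) : Amb ρ ρ₀) = 0
    rw [← h]
    exact hpi.frobenius x

/-- The trace family is continuous. [folklore] -/
theorem continuous_traceR : Continuous (traceR (ρ := ρ) (ρ₀ := ρ₀)) := by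
  refine Continuous.subtype_mk (continuous_pi fun s => ?_) _
  exact FramedRep.continuous_trace s.rep

/-- **The pseudocharacter of the trace algebra**: `T = (tr ρ')_{ρ'} : Γ_F → R_tr`, continuous of dimension `2`.
[cite: BellaicheChenevier2009, §1.2.1] -/
def pseudochar : ContinuousPseudocharacter (absoluteGaloisGroup F) (ring ρ ρ₀) 2 :=
  ⟨traceR, isPseudocharacter_traceR, continuous_traceR⟩

/-- Unfolding lemma for `pseudochar`. [folklore] -/
@[simp] theorem pseudochar_apply (g : absoluteGaloisGroup F) :
    pseudochar (ρ := ρ) (ρ₀ := ρ₀) g = traceR g := rfl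

/-- **(G) the traces topologically generate `R_tr`** (by construction: `R_tr` is the closure of the
subring they generate, and the closure inside the subspace `R_tr` is the trace of the ambient closure).
[folklore] -/
theorem traces_dense :
    (Subring.closure (Set.range (pseudochar (ρ := ρ) (ρ₀ := ρ₀) :
      absoluteGaloisGroup F → ring ρ ρ₀))).topologicalClosure = ⊤ := by
  refine eq_top_iff.2 fun r _ => ?_
  -- the image of the inner subring closure is the ambient subring closure
  have himage : ((ring ρ ρ₀).subtype '' (Subring.closure (Set.range (pseudochar (ρ := ρ) (ρ₀ := ρ₀) :
      absoluteGaloisGroup F → ring ρ ρ₀)) : Set (ring ρ ρ₀))) =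
      (Subring.closure (Set.range (tracePi ρ ρ₀)) : Set (Amb ρ ρ₀)) := by
    rw [← Subring.coe_map, RingHom.map_closure]
    congr 2
    refine Set.ext fun f => ⟨?_, ?_⟩
    · rintro ⟨x, ⟨g, hg⟩, hx⟩
      exact ⟨g, by rw [← hx, ← hg]; rfl⟩
    · rintro ⟨g, hg⟩
      exact ⟨traceR g, ⟨g, rfl⟩, hg⟩
  change r ∈ closure (Subring.closure (Set.range (pseudochar (ρ := ρ) (ρ₀ := ρ₀) :
      absoluteGaloisGroup F → ring ρ ρ₀)) : Set (ring ρ ρ₀))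
  rw [Topology.IsEmbedding.subtypeVal.closure_eq_preimage_closure_image, Set.mem_preimage]
  change ((ring ρ ρ₀).subtype r) ∈ closure ((ring ρ ρ₀).subtype '' _)
  rw [himage]
  exact r.2

end TraceHost

/-- **Sub-goal `stub_traceHostDense` of `stub_host`** (clause (G) of `Host` for the trace algebra): the values of
the pseudocharacter `T = (tr ρ')_{ρ'}` topologically generate the trace algebra `R_tr` (`TraceHost.traces_dense`).
[folklore] -/
theorem stub_traceHostDense : ∀ (F : Type) [Field F] [NumberField F] (p : ℕ) [Fact p.Prime] (ρ : FramedGaloisRep F (PadicAlgCl p) 2) (ρ₀ : absoluteGaloisGroup F →* GL (Fin 2) (TraceHost.Oint p)), (Subring.closure (Set.range (TraceHost.pseudochar (ρ := ρ) (ρ₀ := ρ₀) : absoluteGaloisGroup F → TraceHost.ring ρ ρ₀))).topologicalClosure = ⊤ :=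
  fun _ _ _ _ _ _ _ => TraceHost.traces_dense

end Summit.Langlands.Langlands.Cruxes.ProModularOfGKBound.TwoLeafFern

end
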